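import Summits.ABC.StewartYu.ArchG3HalfValues
import Summits.ABC.StewartYu.ArchG3Values
import HarnessLib

/-!
# Cell abc-stewartyu, rung A1.L (crux r2 `ArchCoreRat`), WP-L.A parcel P-A6 (Kummer half-step), part 3: DESCENT ALGEBRA — the parity class
# of a pivot, the re-based halved exponents, the class sum as a value of the RE-INDEXED family, and the change of Δ-basis

`Summits/ABC/StewartYu/ArchG3HalfDescent.lean` — sequel to `ArchG3HalfValues` (cell `abc-stewartyu`, HOME `run/shared/lean/pub/abc-stewartyu/`;
TRANCHE PLAN v1.2 §4′ P-A6; seat lp-1 g8).  Definitions (`parityClass`, `halfDiff`) and theorems on `ArchG3Setup`; no named fact.  Place-free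
algebra of Nesterenko's step `(s, n) → (s+1, 0)` (LNM 1819 §4.3 (4.46)–(4.51), Lemma 4.4) for the generic class family in Δ-form; archimedean
twin of `PadicG3HalfRebase` / `PadicG3HalfDescent` / `PadicG3HalfStep` (seat p2-g4), WITHOUT sign classes (the generators are positive reals):

* `parityClass v B i₀ = {i ∈ B : vᵢ ≡ v_{i₀} (mod 2)}` — at an odd point `s` it is exactly the fibre `{oddSet(vᵢ) s = oddSet(v_{i₀}) s}` of the
  class sums (`parityClass_eq_filter_oddSet`);
* `halfDiff v i₀ i = (vᵢ − v_{i₀})/2`, `eq_add_two_smul_halfDiff`, the new interval box `lo′ = −⌊(v_{i₀} − lo)/2⌋`, `L′ = ⌊L/2⌋`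
  (`halfDiff_box`, `halfDiff_lo_le`), `abs_Lsum_halfDiff_sub_le` (the slab HALVES: radius `w/2` around the new centre
  `γ′ = (γ − Lsum v_{i₀})/2`, `|γ′| ≤ w/2`);
* **`halfClassVec_pivot_eq`** — the class sum of the pivot's class is a non-zero multiple of a value of the RE-INDEXED family at the INTEGER
  point `s`: `C_{T₀} = c_a · qEhZ(v_{i₀}) s · archφ R′ (halfDiff v i₀) B′ (pvΔ_old μ) (a, 0) s` when `(Hasse_a Rᵢ)(s/2) = c_a (Hasse_a Rᵢ′)(s)`
  (for `Rᵢ′ = Rᵢ ∘ (Y₀/2)`, `c_a = 2ᵃ`; print's `Δ(2^{S−s−1}ζ; ℓ₀, H)`);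
* **`archφ_pvΔ_rebase`** — the change of Δ-basis: if the Δ-sums with the OLD arguments `c(𝔛ₖ(vᵢ) − eₖ)`, `vᵢ = v₀ + 2wᵢ`, vanish for all
  `|μ| ≤ U`, then so do the Δ-sums with ANY new arguments `c′(𝔛ₖ(wᵢ) − e′ₖ)`, `c′ ≠ 0` (both families span the polynomials of total degree
  `≤ U` in `𝔛(wᵢ)`; `DirWeights.dirMoment_eq_zero_of_dirDelta_sums` + `dirDelta_sums_iff`).

WHAT THIS IS NOT: the analysis (part 2) and the half-step on the invariant (part 4, `ArchG3LevelStepH`); no crux moves.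

## References
* Yu. V. Nesterenko, LNM 1819 (2003) — §3.5 (3.25)–(3.30) p. 69–71, §4 (4.1)–(4.6) p. 79–81, §4.3 (4.46)–(4.51), Lemma 4.4, p. 93–95. [Nesterenko2003]
* K. Yu, Compositio Math. 74 (1990) — (2.101)–(2.106) (the `p`-adic model). [Yu1990]
-/

noncomputable section

open Finset Polynomial
open Literature.NumberTheory.Transcendental
open Literature.NumberTheory.Transcendental.CW77 (mono ev)
open Literature.NumberTheory.Transcendental.CW77.Setup (Tau tauNorm)
open Summit.ABC.StewartYu.DirWeights (dirDelta dirMoment_eq_zero_of_dirDelta_sums dirDelta_sums_iff)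
open scoped Nat

namespace Summit.ABC.StewartYu

namespace ArchG3Setup

variable (S : ArchG3Setup) {ι : Type*} (R : ι → ℚ[X]) (v : ι → Fin S.n → ℤ)

/-! ### The parity class of a pivot and the halved exponents -/

/-- The parity class of `i₀` in `B`: `{i ∈ B : vᵢⱼ ≡ v_{i₀ j} (mod 2) for all j}`. [cite: Nesterenko2003, §4.3 (4.46); shape only] -/
def parityClass (B : Finset ι) (i₀ : ι) : Finset ι := B.filter fun i => ∀ j, (v i j - v i₀ j) % 2 = 0

/-- `parityClass ⊆ B`. [folklore] -/
theorem parityClass_subset (B : Finset ι) (i₀ : ι) : S.parityClass v B i₀ ⊆ B := filter_subset _ _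

/-- Membership. [folklore] -/
theorem mem_parityClass {B : Finset ι} {i₀ i : ι} : i ∈ S.parityClass v B i₀ ↔ i ∈ B ∧ ∀ j, 2 ∣ v i j - v i₀ j := by
  unfold parityClass
  rw [mem_filter]
  exact ⟨fun ⟨h1, h2⟩ => ⟨h1, fun j => Int.dvd_of_emod_eq_zero (h2 j)⟩,
    fun ⟨h1, h2⟩ => ⟨h1, fun j => Int.emod_eq_zero_of_dvd (h2 j)⟩⟩

/-- `i₀ ∈ parityClass v B i₀` when `i₀ ∈ B`. [folklore] -/
theorem self_mem_parityClass {B : Finset ι} {i₀ : ι} (h : i₀ ∈ B) : i₀ ∈ S.parityClass v B i₀ :=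
  (S.mem_parityClass v).mpr ⟨h, fun j => by simp⟩

/-- **At an odd point the parity class is the fibre of the class sums**: `{i ∈ B : oddSet(vᵢ) s = oddSet(v_{i₀}) s} = parityClass v B i₀`.
[cite: Nesterenko2003, §4.3 (4.46)–(4.47), p. 93] -/
theorem parityClass_eq_filter_oddSet (B : Finset ι) (i₀ : ι) {s : ℤ} (hs : Odd s) :
    B.filter (fun i => S.oddSet (v i) s = S.oddSet (v i₀) s) = S.parityClass v B i₀ := by
  ext i
  rw [mem_filter, S.mem_parityClass v]
  exact ⟨fun ⟨h1, h2⟩ => ⟨h1, S.congr_of_oddSet_eq hs h2⟩, fun ⟨h1, h2⟩ => ⟨h1, S.oddSet_eq_of_congr h2 s⟩⟩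

/-- The halved relative exponents `halfDiff v i₀ i = (vᵢ − v_{i₀})/2`. [cite: Nesterenko2003, §4 (4.1), §4.3 (4.48); shape only] -/
def halfDiff (i₀ i : ι) : Fin S.n → ℤ := fun j => (v i j - v i₀ j) / 2

/-- On the parity class: `vᵢ = v_{i₀} + 2·halfDiff`. [folklore] -/
theorem eq_add_two_smul_halfDiff {i₀ i : ι} (hpar : ∀ j, 2 ∣ v i j - v i₀ j) :
    v i = v i₀ + (2 : ℤ) • S.halfDiff v i₀ i := by
  funext j
  simp only [halfDiff, Pi.add_apply, Pi.smul_apply, smul_eq_mul]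
  obtain ⟨c, hc⟩ := hpar j
  rw [hc, Int.mul_ediv_cancel_left _ two_ne_zero]
  omega

/-- `halfDiff v i₀ i₀ = 0`. [folklore] -/
theorem halfDiff_self (i₀ : ι) : S.halfDiff v i₀ i₀ = 0 := by
  funext j; simp [halfDiff]

/-- **The new interval box**: with `loⱼ ≤ vᵢⱼ ≤ loⱼ + Lⱼ` on `B` (and for `i₀`), the halved exponents satisfy
`lo′ⱼ ≤ halfDiff ≤ lo′ⱼ + ⌊Lⱼ/2⌋`, `lo′ⱼ = −⌊(v_{i₀ j} − loⱼ)/2⌋`. [cite: Nesterenko2003, §4.3 (4.48)–(4.49), p. 94; shape only] -/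
theorem halfDiff_box {i₀ i : ι} (hpar : ∀ j, 2 ∣ v i j - v i₀ j) {lo : Fin S.n → ℤ} {L : Fin S.n → ℕ}
    (hbox : ∀ j, lo j ≤ v i j ∧ v i j ≤ lo j + L j) (hbox₀ : ∀ j, lo j ≤ v i₀ j ∧ v i₀ j ≤ lo j + L j) (j : Fin S.n) :
    -((v i₀ j - lo j) / 2) ≤ S.halfDiff v i₀ i j ∧ S.halfDiff v i₀ i j ≤ -((v i₀ j - lo j) / 2) + ((L j / 2 : ℕ) : ℤ) := by
  have h1 := hbox j
  have h2 := hbox₀ j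
  obtain ⟨c, hc⟩ := hpar j
  have hw : S.halfDiff v i₀ i j = c := by
    simp only [halfDiff]; rw [hc, Int.mul_ediv_cancel_left _ two_ne_zero]
  rw [hw]
  push_cast
  constructor <;> omega

/-- The new interval contains `0`: `lo′ⱼ ≤ 0 ≤ lo′ⱼ + ⌊Lⱼ/2⌋`. [folklore] -/
theorem halfDiff_lo_le {i₀ : ι} {lo : Fin S.n → ℤ} {L : Fin S.n → ℕ} (hlo : ∀ j, lo j ≤ 0 ∧ 0 ≤ lo j + L j)
    (hbox₀ : ∀ j, lo j ≤ v i₀ j ∧ v i₀ j ≤ lo j + L j) (j : Fin S.n) :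
    -((v i₀ j - lo j) / 2) ≤ 0 ∧ 0 ≤ -((v i₀ j - lo j) / 2) + ((L j / 2 : ℕ) : ℤ) := by
  have h1 := hlo j
  have h2 := hbox₀ j
  push_cast
  constructor <;> omega

/-- **The slab halves**: `Lsum (halfDiff) = (Lsum vᵢ − Lsum v_{i₀})/2`, so `|Lsum vᵢ − γ| ≤ w` gives
`|Lsum (halfDiff) − γ′| ≤ w/2` with the new centre `γ′ = (γ − Lsum v_{i₀})/2` (print's factor `2^{−s}` in the growth term (4.27)).
[cite: Nesterenko2003, §4.2 (4.27), §4.3 (4.50), p. 88–94; shape only] -/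
theorem abs_Lsum_halfDiff_sub_le {i₀ i : ι} (hpar : ∀ j, 2 ∣ v i j - v i₀ j) {γ w : ℝ} (hi : |S.Lsum (v i) - γ| ≤ w) :
    |S.Lsum (S.halfDiff v i₀ i) - (γ - S.Lsum (v i₀)) / 2| ≤ w / 2 := by
  have e1 : S.Lsum (v i) = S.Lsum (v i₀) + 2 * S.Lsum (S.halfDiff v i₀ i) := by
    conv_lhs => rw [S.eq_add_two_smul_halfDiff v hpar]
    rw [← S.add_Lsum, S.Lsum_smul]; push_cast; ring
  have e2 : S.Lsum (S.halfDiff v i₀ i) - (γ - S.Lsum (v i₀)) / 2 = (S.Lsum (v i) - γ) / 2 := by rw [e1]; ring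
  rw [e2, abs_div, abs_two]
  linarith

/-- The new centre is small: `|γ′| = |γ − Lsum v_{i₀}|/2 ≤ w/2` (the pivot lies in the slab). [folklore] -/
theorem abs_half_center_le {i₀ : ι} {γ w : ℝ} (hi₀ : |S.Lsum (v i₀) - γ| ≤ w) : |(γ - S.Lsum (v i₀)) / 2| ≤ w / 2 := by
  rw [abs_div, abs_two, abs_sub_comm]
  linarith

/-! ### The class sum of the pivot's class as a value of the re-indexed family -/

/-- **The pivot's class sum** at an odd `s`: for ANY integer coefficients `pv′` (in the frame `pvΔ v pv c e μ`) and `Y₀`-weights with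
`(Hasse_a Rᵢ)(s/2) = c_a · (Hasse_a Rᵢ′)(s)` on `B`,
`halfClassVec R v B pv′ (a,0) s (oddSet(v_{i₀}) s) = c_a · qEhZ(v_{i₀}) s · archφ R′ (halfDiff v i₀) (parityClass v B i₀) pv′ (a,0) s`.
[cite: Nesterenko2003, §4.3 (4.46)–(4.48), p. 93–94] -/
theorem halfClassVec_pivot_eq (B : Finset ι) (pv' : ι → ℤ) (i₀ : ι) {s : ℤ} (hs : Odd s) (a : ℕ) {R' : ι → ℚ[X]} {ca : ℚ}
    (hRR' : ∀ i ∈ B, (hasseDeriv a (R i)).eval ((s : ℚ) / 2) = ca * (hasseDeriv a (R' i)).eval (s : ℚ)) :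
    S.halfClassVec R v B pv' ((a, 0) : Tau S.n) s (S.oddSet (v i₀) s) =
      ca * S.qEhZ (v i₀) s * S.archφ R' (S.halfDiff v i₀) (S.parityClass v B i₀) pv' ((a, 0) : Tau S.n) s := by
  classical
  unfold halfClassVec archφ
  rw [S.parityClass_eq_filter_oddSet v B i₀ hs, mul_sum]
  refine sum_congr rfl fun i hi => ?_
  have hiB : i ∈ B := S.parityClass_subset v B i₀ hi
  have hpar : ∀ j, 2 ∣ v i j - v i₀ j := ((S.mem_parityClass v).mp hi).2
  unfold rHalf
  simp only
  simp only [ArchG3Setup.zγpow_zero, mul_one]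
  rw [hRR' i hiB]
  have hq : S.qEhZ (v i) s = S.qEhZ (v i₀) s * ∏ j, S.α j ^ (S.halfDiff v i₀ i j * s) := by
    conv_lhs => rw [S.eq_add_two_smul_halfDiff v hpar]
    exact S.qEhZ_add_two_mul (v i₀) (S.halfDiff v i₀ i) s
  rw [hq]
  ring

/-! ### The change of Δ-basis along the class -/

/-- **Re-basing the Δ-weights**: on a family with `vᵢ = v₀ + 2wᵢ` (`i ∈ B′`), if the Δ-sums built with the OLD arguments
`c(𝔛ₖ(vᵢ) − eₖ)` vanish at `(a, 0; x)` for all `|μ| ≤ U` (with the exponents `w` in the monomial part), then the Δ-sums with the NEW arguments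
`c′(𝔛ₖ(wᵢ) − e′ₖ)` vanish for all `|μ′| ≤ U`, for every `c′ ≠ 0`, `e′` (the two families of directional weights span the same polynomials of
total degree `≤ U` in `𝔛(wᵢ)`, since `𝔛ₖ(vᵢ) = 𝔛ₖ(v₀) + 2𝔛ₖ(wᵢ)`). [cite: Nesterenko2003, §3.5 (3.25)–(3.30), §4 (4.1)–(4.6), p. 69–81] -/
theorem archφ_pvΔ_rebase (B' : Finset ι) (pv : ι → ℤ) {c : ℤ} (hc : c ≠ 0) (e : Fin S.n → ℤ) (w : ι → Fin S.n → ℤ)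
    (v₀ : Fin S.n → ℤ) (hvw : ∀ i ∈ B', v i = v₀ + (2 : ℤ) • w i) (R' : ι → ℚ[X]) (a : ℕ) (x : ℤ) (U : ℕ)
    (hold : ∀ μ : Fin S.n → ℕ, ∑ k, μ k ≤ U → S.archφ R' w B' (S.pvΔ v pv c e μ) ((a, 0) : Tau S.n) x = 0)
    {c' : ℤ} (hc' : c' ≠ 0) (e' : Fin S.n → ℤ) :
    ∀ μ' : Fin S.n → ℕ, ∑ k, μ' k ≤ U → S.archφ R' w B' (S.pvΔ w pv c' e' μ') ((a, 0) : Tau S.n) x = 0 := by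
  classical
  -- weights and coordinates of the moment problem
  set W : ι → ℚ := fun i => (pv i : ℚ) * (hasseDeriv a (R' i)).eval (x : ℚ) * ∏ j, S.α j ^ (w i j * x) with hW
  set Xf : ι → Fin S.n → ℚ := fun i k => (S.𝔛 (w i) k : ℚ) with hXf
  -- the old arguments in the new coordinates: `c(𝔛ₖ(vᵢ) − eₖ) = (2c)·(𝔛ₖ(wᵢ) − e″ₖ)`, `e″ₖ = (eₖ − 𝔛ₖ(v₀))/2`
  set e'' : Fin S.n → ℚ := fun k => ((e k : ℚ) - (S.𝔛 v₀ k : ℚ)) / 2 with he''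
  have hyold : ∀ i ∈ B', ∀ k, ((S.yΔ c e (v i) k : ℤ) : ℚ) = (2 * c : ℚ) * (Xf i k - e'' k) := by
    intro i hi k
    rw [S.yΔ_cast, hvw i hi, S.𝔛_add_smul]
    simp only [hXf, he'']
    push_cast
    ring
  -- both Δ-sums through the common weights `W` (the factor `pv i` sits inside `pvΔ`)
  have hsumΔ : ∀ (cc : ℤ) (ee : Fin S.n → ℤ) (uu : ι → Fin S.n → ℤ) (μ : Fin S.n → ℕ),
      S.archφ R' w B' (S.pvΔ uu pv cc ee μ) ((a, 0) : Tau S.n) x =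
        ∑ i ∈ B', W i * ∏ k, (dirDelta ℚ (μ k)).eval (((S.yΔ cc ee (uu i) k : ℤ) : ℚ)) := by
    intro cc ee uu μ
    unfold archφ
    refine sum_congr rfl fun i _ => ?_
    simp only [ArchG3Setup.zγpow_zero, mul_one, hW]
    rw [S.pvΔ_cast]
    ring
  -- old sums in DirWeights shape
  have hzero : ∀ μ : Fin S.n → ℕ, ∑ k, μ k ≤ U →
      ∑ i ∈ B', W i * ∏ k, (dirDelta ℚ (μ k)).eval ((2 * c : ℚ) * (Xf i k - e'' k)) = 0 := by
    intro μ hμ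
    have h := hold μ hμ
    rw [hsumΔ] at h
    rw [← h]
    refine sum_congr rfl fun i hi => ?_
    congr 1
    exact prod_congr rfl fun k _ => by rw [hyold i hi k]
  have h2c : ∀ _k : Fin S.n, (2 * c : ℚ) ≠ 0 := fun _ => by exact_mod_cast (mul_ne_zero two_ne_zero hc)
  have hmom := dirMoment_eq_zero_of_dirDelta_sums B' W Xf U h2c e'' hzero
  have hc'q : ∀ _k : Fin S.n, (c' : ℚ) ≠ 0 := fun _ => by exact_mod_cast hc'
  have hnew := (dirDelta_sums_iff B' W Xf U hc'q (fun k => (e' k : ℚ))).mp hmom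
  intro μ' hμ'
  rw [hsumΔ]
  have h := hnew μ' hμ'
  rw [← h]
  refine sum_congr rfl fun i _ => ?_
  congr 1
  exact prod_congr rfl fun k _ => by rw [S.yΔ_cast]

end ArchG3Setup

end Summit.ABC.StewartYu

end
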